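import Summits.Ventures.HodgeRepro.Night4OpenFrontier
import Summits.Ventures.HodgeRepro.Night4ReducedDimRoute

/-!
# The open frontier with the §3.2 count on the kernel: `S0 ⇐ printed ∧ LemmasLP ∧ LemmaR_faces ∧ DimReduced ∧ (∀ d ≥ 8, S4facesDeg d)`

Blind re-derivation cell `pub-hodge-repro`, seat `night-4` (ROUTE HARDENING for the Monday FINAL, gen 2).  Target tree path
`lean/Summits/Ventures/HodgeRepro/Night4OpenFrontierDim.lean`.

`Night4OpenFrontier.lean` states the open frontier with the §3.2 count as the hypothesis `ReducedFourfold_deg6` («`B_red`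
is an abelian fourfold in degree 6»); gen 1's `Night4ReducedDimRoute.lean` reduces that count to the cell's dictionary
`DimReduced` (`dim B_red = TypeDatum.redDim`, one simple factor of dimension `[F:ℚ]/(2|rstab T|)` per right-translation
class) — the count itself (`redDim = 4` for every face of every degree-6 type datum) is a kernel theorem
(`Night4ReducedDimTransport.lean`, `decide +kernel` at `C6` + transport).  This file composes the two: the frontier
statement with `DimReduced` in place of `ReducedFourfold_deg6`.

It also records a corollary of the vacuity lemmas: below degree 6 there are NO rank-four faces (a face needs eight
distinct CM types, `TypeDatum.six_le_card_of_isFace`), so in degrees 2 and 4 — the quadratic and the quartic Galois CM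
fields — the cell's Lemmas L / P alone give S4 and S0 (`S4deg_of_LemmasLPdeg_of_lt_six`, `S0deg_of_LemmasLPdeg_of_lt_six`):
every (eq2)-multiset there decomposes into conjugate pairs, and no Markman / Hazama input is consumed.  (Degree 2 is also
gen 1's `S0deg2_of_vanGeemen`; degree 4 is new as a statement: ROUTE.md §1 row S4 reads «OPEN for r ≥ 2, p ≥ 2 in
general», and on the faces' reading the first degree with anything to prove is 6, closed by Markman, then 8.)

Gen 3 adds the one-theorem form of «the first open degree is 8»: `S4deg_of_lt_eight` / `S0deg_of_lt_eight` — for EVERY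
`d < 8`, `S4deg d` (resp. `S0deg d`) follows from the cell's lemmas in degree `d` (`LemmasLPdeg d`, `LemmaR_faces`,
`DimReduced`) and the printed inputs (`AlgPull`, `S3`, Markman Cor 1.6.1): degrees `< 6` and the odd degrees by vacuity
(`S4facesDeg_of_card_lt_six`, `S4facesDeg_of_odd` — there is no Galois CM field of odd degree), degree 6 by Markman through
Lemma R and the kernel count (gen 1's `S0deg6_of_Markman'`).  NO open input is closed; HC_CM is NOT proved.
-/

namespace HodgeRepro.Route

variable (𝓚 : KnownRegimeData)

/-- **The open frontier of `S4faces`, count on the kernel**: `S4faces ⇐ AlgPull ∧ LemmaR_faces ∧ DimReduced ∧ Markman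
Cor 1.6.1 ∧ (∀ d ≥ 8, S4facesDeg d)`. -/
theorem S4faces_of_open_frontier' (hpull : AlgPull 𝓚.toRouteData) (hR : LemmaR_faces 𝓚) (hD : DimReduced 𝓚)
    (hM : Markman2025_Cor1_6_1 𝓚) (hopen : ∀ d : ℕ, 8 ≤ d → S4facesDeg 𝓚.toRouteData d) :
    S4faces 𝓚.toRouteData :=
  S4faces_of_open_frontier 𝓚 hpull hR (ReducedFourfold_deg6_of_DimReduced 𝓚 hD) hM hopen

/-- **THE EXACT OPEN FRONTIER, count on the kernel**: `S0 ⇐ AlgPull ∧ S1 ∧ S2 ∧ S3 ∧ LemmasLP ∧ LemmaR_faces ∧ DimReduced ∧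
Markman2025_Cor1_6_1 ∧ (∀ d ≥ 8, S4facesDeg d)` — the cell's unprinted inputs are now exactly Lemmas L / P, Lemma R and
the dimension dictionary; the degree-6 count is kernel. -/
theorem S0_of_open_frontier' (hpull : AlgPull 𝓚.toRouteData)
    (h : S1 𝓚.toRouteData ∧ S2 𝓚.toRouteData ∧ S3 𝓚.toRouteData) (hLP : LemmasLP 𝓚.toRouteData)
    (hR : LemmaR_faces 𝓚) (hD : DimReduced 𝓚) (hM : Markman2025_Cor1_6_1 𝓚)
    (hopen : ∀ d : ℕ, 8 ≤ d → S4facesDeg 𝓚.toRouteData d) : S0 𝓚.toRouteData :=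
  S0_of_open_frontier 𝓚 hpull h hLP hR (ReducedFourfold_deg6_of_DimReduced 𝓚 hD) hM hopen

section LowDegree

variable (𝓗 : RouteData)

/-- **Below degree 6, Lemmas L / P alone give S4**: `S4facesDeg d` is vacuous for `d < 6` (`S4facesDeg_of_card_lt_six`),
so the degree-`d` slice of Lemmas L / P (`LemmasLPdeg d : S4facesDeg d → S4deg d`) yields `S4deg d` outright. -/
theorem S4deg_of_LemmasLPdeg_of_lt_six {d : ℕ} (hd : d < 6) (hLP : LemmasLPdeg 𝓗 d) : S4deg 𝓗 d :=
  hLP (S4facesDeg_of_card_lt_six 𝓗 d hd)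

/-- **… and S0 in degrees 2 and 4** from `AlgPull ∧ S3 ∧ LemmasLPdeg d` (gen 1's `S0deg_of_S3_S4deg`). -/
theorem S0deg_of_LemmasLPdeg_of_lt_six (hpull : AlgPull 𝓗) (h3 : S3 𝓗) {d : ℕ} (hd : d < 6)
    (hLP : LemmasLPdeg 𝓗 d) : S0deg 𝓗 d :=
  S0deg_of_S3_S4deg 𝓗 hpull h3 (S4deg_of_LemmasLPdeg_of_lt_six 𝓗 hd hLP)

end LowDegree

section BelowEight

variable (𝓚 : KnownRegimeData)

/-- **The first open degree is 8, on the S4 side**: for every `d < 8`, `S4deg d ⇐ AlgPull ∧ LemmasLPdeg d ∧ LemmaR_faces ∧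
DimReduced ∧ Markman2025_Cor1_6_1` — `d < 6` and odd `d` by vacuity of `S4facesDeg d`, `d = 6` by Markman (gen 1's
`S4facesDeg6_of_Markman'`). -/
theorem S4deg_of_lt_eight (hpull : AlgPull 𝓚.toRouteData) {d : ℕ} (hd : d < 8) (hLP : LemmasLPdeg 𝓚.toRouteData d)
    (hR : LemmaR_faces 𝓚) (hD : DimReduced 𝓚) (hM : Markman2025_Cor1_6_1 𝓚) : S4deg 𝓚.toRouteData d := by
  rcases Nat.lt_or_ge d 6 with h6 | h6
  · exact S4deg_of_LemmasLPdeg_of_lt_six 𝓚.toRouteData h6 hLP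
  · rcases Nat.even_or_odd d with he | ho
    · have hd6 : d = 6 := by
        obtain ⟨k, hk⟩ := he
        omega
      subst hd6
      exact hLP (S4facesDeg6_of_Markman' 𝓚 hpull hR hD hM)
    · exact hLP (S4facesDeg_of_odd 𝓚.toRouteData d ho)

/-- **The first open degree is 8**: for every `d < 8`, `S0deg d ⇐ AlgPull ∧ S3 ∧ LemmasLPdeg d ∧ LemmaR_faces ∧ DimReduced ∧
Markman2025_Cor1_6_1` — the Hodge conjecture for every CM abelian variety whose Galois CM field has degree `< 8`, modulo
the cell's lemmas and the printed inputs (`S3`, `AlgPull`, Markman Cor 1.6.1). -/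
theorem S0deg_of_lt_eight (hpull : AlgPull 𝓚.toRouteData) (h3 : S3 𝓚.toRouteData) {d : ℕ} (hd : d < 8)
    (hLP : LemmasLPdeg 𝓚.toRouteData d) (hR : LemmaR_faces 𝓚) (hD : DimReduced 𝓚) (hM : Markman2025_Cor1_6_1 𝓚) :
    S0deg 𝓚.toRouteData d :=
  S0deg_of_S3_S4deg 𝓚.toRouteData hpull h3 (S4deg_of_lt_eight 𝓚 hpull hd hLP hR hD hM)

end BelowEight

end HodgeRepro.Route
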